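import Summits.HodgeConjecture.HodgeConjecture.Theorems.Ring2WeilCoverageNormCriteria
import Summits.HodgeConjecture.HodgeConjecture.Theorems.Ring2WeilCoverageNormTableB
import HarnessLib

/-!
# Weil-type family coverage — the `ξ`-windows of `SL₂(𝔽_q)` on the NON-SPLIT R4 rows `(3, ℚ(√-q), [2])`, `q = 11, 19, 43` (ring2-b02, gen 60)

research route conditional on HC_CM; not a corollary; Q11.4-sentence-2 already refuted in dim ≥ 3.

Ring 2, WEIL-TYPE FAMILY-COVERAGE CENSUS (`HOME/WEIL-FAMILY-COVERAGE.md` `## b02 (g = 6)`, block b02.20 P.S. 1–3, owner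
ring2-b02).  For a prime `q ≡ 3 (mod 4)` the group `G = SL₂(𝔽_q)` has two faithful characters `ξ, ξ̄` of degree
`(q+1)/2` with `ℚ(ξ) = K = ℚ(√-q)` and Schur index one (the halves of the reducible principal series `Ind_B^G α`,
`α` the Legendre character of the Borel `B`; the intertwiner `J` has `J² = α(-1) q = -q`).  By Lange–Rodríguez
Cor. 3.5.10 (`ρ_{B₀} = ρ_B ⊕ (ξ ⊕ ξ̄)`, `B₀ = ker α`) the `ξ`-factor of a `G`-curve `C̃ → ℙ¹` is the PRYM VARIETY
`P(C̃/B₀ → C̃/B)` of the double cover of the `(q+1)`-ic.  The census computed (two disjoint exact routes: the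
Morita-reduced Fox/fatgraph model `smono.py`, and the integral homology of the coset cover with the Hecke operator,
ring2-b05's ENGINE D) the `K`-signature `(3,3)` and van Geemen's `det H` for the sixfold data of these windows and
found (LAW X of the census) that the discriminant class is `[2]^{#(branch points of type -h, h of odd order)}`,
non-trivial exactly when `q ≡ 3 (mod 8)`.  THIS FILE pins the arithmetic of three representative data on the three
class-number-one R4 fields reached:
* `q = 11`: the rigid `(10,10,10)`-triangle curve (genus 463; `C̃/B` elliptic; `det H = -1/8000000`) and the
  one-parameter family `(0;10,3,3,3)` (genus 595; `det H = -9/25600000`; monodromy Zariski-dense in `SU(3,3)`):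
  class `[-2]`, NOT the split class `[-1]` — row W6.11.2 = `(3, ℚ(√-11), a ≡ 2)` (the non-split statement is the
  cell's `negTwo_ne_split_eleven_of_odd`, gen 49);
* `q = 19`: the rigid `(18,3,4)`-datum whose
  Prym is the JACOBIAN of a hyperelliptic genus-6 curve (`C̃/B ≅ ℙ¹`; second-route value `det H = -896`) and the rigid
  `(10,5,5)`-datum (`det H = -2048`): class `[-2] ≠ [-1]` — row W6.19.2 (the non-split statement is the cell's
  `sixfold_sqrtNeg19_neg2_ne_split`, `Ring2WeilCoverageNormTableB`);
* `q = 43`: the rigid `(14,3,3)`-datum (`det H = -30208`): class `[-2] ≠ [-1]` — row W6.43.2 (via the cell's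
  `sixfold_sqrtNeg43_neg2_ne_split`).
The monodromy / density statements and LAW X itself are exact computations of the census, not kernel facts.

No `def`, no named fact, no `sorry`; nothing here is a statement about Hodge classes; `HC_CM` is used nowhere.

References: [cite: vanGeemen1994HodgeAV, 5.2 and (5.4.1)].
-/

noncomputable section

set_option linter.dupNamespace false

open Literature.AlgebraicGeometry.Motives
open Literature.AlgebraicGeometry.VanGeemen1994
open Summit.HodgeConjecture.HodgeConjecture.Ring2.Hypotheses
open Summit.HodgeConjecture.Ring2WeilNormDescent

namespace Summit.HodgeConjecture.HodgeConjecture.Ring2.WeilCoverage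

/-! ### `q = 11`: row W6.11.2 = `(3, ℚ(√-11), a ≡ 2)` -/

/-- **the `ξ₆`-Prym of the rigid `(10,10,10)`-triangle curve with group `SL₂(𝔽₁₁)` (genus 463; `C̃/B` elliptic, `C̃/B₀` of genus 7, polarisation type `(1⁵,2)`): `ℚ(√-11)`-signature `(3,3)`, literal `det H = -1/8000000 = -1/(2⁹·5⁶)`; `(-1/8000000)⁻¹·(-2) = 16000000 = 4000²` is a norm, so the class is `[-2]` — the NON-split row W6.11.2.**
research route conditional on HC_CM; not a corollary; Q11.4-sentence-2 already refuted in dim ≥ 3. [cite: vanGeemen1994HodgeAV, (5.4.1)] -/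
theorem sl2_11_rigid_10_10_10_mk_detH_eq_negTwo :
    (QuotientGroup.mk (Units.mk0 ((-1 : ℚ) / 8000000) (by norm_num)) : weilNormResidueGroup 11) =
      QuotientGroup.mk (Units.mk0 (-2 : ℚ) (by norm_num)) := by
  rw [QuotientGroup.eq]
  have e : (Units.mk0 ((-1 : ℚ) / 8000000) (by norm_num))⁻¹ * Units.mk0 (-2 : ℚ) (by norm_num) =
      Units.mk0 (16000000 : ℚ) (by norm_num) := Units.ext (by norm_num)
  rw [e]
  exact mem_normUnitsSubgroup_of_sq_add_mul_sq _ (4000 : ℚ) (0 : ℚ) (by norm_num)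

/-- … hence NOT the split class `[(-1)³]` (`negTwo_ne_split_eleven_of_odd`: `2 ∉ Nm(ℚ(√-11)ˣ)`, descent at the inert prime 2).
research route conditional on HC_CM; not a corollary; Q11.4-sentence-2 already refuted in dim ≥ 3. [cite: vanGeemen1994HodgeAV, (5.4.1)] -/
theorem sl2_11_rigid_10_10_10_mk_detH_ne_split :
    (QuotientGroup.mk (Units.mk0 ((-1 : ℚ) / 8000000) (by norm_num)) : weilNormResidueGroup 11) ≠
      splitDiscriminantClass 3 11 := by
  rw [sl2_11_rigid_10_10_10_mk_detH_eq_negTwo]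
  exact negTwo_ne_split_eleven_of_odd (by decide)

/-- **the ONE-PARAMETER family `(0; 10,3,3,3)` of `SL₂(𝔽₁₁)`-curves (genus 595; `ξ₆`-Prym = Prym of a 4-point double cover of a genus-5 dodecic, type `(1,2⁵)`; monodromy Zariski-dense in `SU(3,3)`: very general member `Hg = SU(3,3)`, `End⁰ = ℚ(√-11)`): `(3,3)`, literal `det H = -9/25600000 = -9/(2¹³·5⁵)`; `(-9/25600000)⁻¹·(-2) = 51200000/9 = 1600² + 11·(1600/3)²`, class `[-2]` — row W6.11.2.**
research route conditional on HC_CM; not a corollary; Q11.4-sentence-2 already refuted in dim ≥ 3. [cite: vanGeemen1994HodgeAV, (5.4.1)] -/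
theorem sl2_11_family_10_3_3_3_mk_detH_eq_negTwo :
    (QuotientGroup.mk (Units.mk0 ((-9 : ℚ) / 25600000) (by norm_num)) : weilNormResidueGroup 11) =
      QuotientGroup.mk (Units.mk0 (-2 : ℚ) (by norm_num)) := by
  rw [QuotientGroup.eq]
  have e : (Units.mk0 ((-9 : ℚ) / 25600000) (by norm_num))⁻¹ * Units.mk0 (-2 : ℚ) (by norm_num) =
      Units.mk0 ((51200000 : ℚ) / 9) (by norm_num) := Units.ext (by norm_num)
  rw [e]
  exact mem_normUnitsSubgroup_of_sq_add_mul_sq _ (1600 : ℚ) ((1600 : ℚ) / 3) (by norm_num)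

/-- … hence NOT the split class: the one-parameter family lies on the non-split row W6.11.2, which has no hyperbolic member.
research route conditional on HC_CM; not a corollary; Q11.4-sentence-2 already refuted in dim ≥ 3. [cite: vanGeemen1994HodgeAV, (5.4.1)] -/
theorem sl2_11_family_10_3_3_3_mk_detH_ne_split :
    (QuotientGroup.mk (Units.mk0 ((-9 : ℚ) / 25600000) (by norm_num)) : weilNormResidueGroup 11) ≠
      splitDiscriminantClass 3 11 := by
  rw [sl2_11_family_10_3_3_3_mk_detH_eq_negTwo]
  exact negTwo_ne_split_eleven_of_odd (by decide)

/-! ### `q = 19`: row W6.19.2 = `(3, ℚ(√-19), a ≡ 2)` -/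

/-- **the `ξ₁₀`-Prym of the rigid `(18,3,4)`-datum of `SL₂(𝔽₁₉)` (genus 1236): `C̃/B ≅ ℙ¹` and `C̃/B₀` is a HYPERELLIPTIC curve of genus 6, so the factor is its JACOBIAN, principally polarised (type `(1⁶)`), of Weil type `(3,3)` over `ℚ(√-19)`; second-route value `det H = -896`; `(-896)⁻¹·(-2) = 1/448 = 7/56²` with `7 = (3/2)² + 19·(1/2)²`, i.e. `1/448 = (3/112)² + 19·(1/112)²`, so the class is `[-2]` — the NON-split row W6.19.2.**
research route conditional on HC_CM; not a corollary; Q11.4-sentence-2 already refuted in dim ≥ 3. [cite: vanGeemen1994HodgeAV, (5.4.1)] -/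
theorem sl2_19_jacobian_18_3_4_mk_detH_eq_negTwo :
    (QuotientGroup.mk (Units.mk0 (-896 : ℚ) (by norm_num)) : weilNormResidueGroup 19) =
      QuotientGroup.mk (Units.mk0 (-2 : ℚ) (by norm_num)) := by
  rw [QuotientGroup.eq]
  have e : (Units.mk0 (-896 : ℚ) (by norm_num))⁻¹ * Units.mk0 (-2 : ℚ) (by norm_num) =
      Units.mk0 ((1 : ℚ) / 448) (by norm_num) := Units.ext (by norm_num)
  rw [e]
  exact mem_normUnitsSubgroup_of_sq_add_mul_sq _ ((3 : ℚ) / 112) ((1 : ℚ) / 112) (by norm_num)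

/-- … hence NOT the split class: a principally polarised hyperelliptic Jacobian on the non-split row W6.19.2.
research route conditional on HC_CM; not a corollary; Q11.4-sentence-2 already refuted in dim ≥ 3. [cite: vanGeemen1994HodgeAV, (5.4.1)] -/
theorem sl2_19_jacobian_18_3_4_mk_detH_ne_split :
    (QuotientGroup.mk (Units.mk0 (-896 : ℚ) (by norm_num)) : weilNormResidueGroup 19) ≠
      splitDiscriminantClass 3 19 := by
  rw [sl2_19_jacobian_18_3_4_mk_detH_eq_negTwo]
  exact sixfold_sqrtNeg19_neg2_ne_split

/-- **the `ξ₁₀`-Prym of the rigid `(10,5,5)`-triangle curve of `SL₂(𝔽₁₉)` (genus 1711; Prym of a 4-point double cover of a genus-5 curve, type `(1,2⁵)`): second-route value `det H = -2048 = -2¹¹`; `(-2048)⁻¹·(-2) = 1/1024 = (1/32)²`, class `[-2]` — row W6.19.2.**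
research route conditional on HC_CM; not a corollary; Q11.4-sentence-2 already refuted in dim ≥ 3. [cite: vanGeemen1994HodgeAV, (5.4.1)] -/
theorem sl2_19_rigid_10_5_5_mk_detH_eq_negTwo :
    (QuotientGroup.mk (Units.mk0 (-2048 : ℚ) (by norm_num)) : weilNormResidueGroup 19) =
      QuotientGroup.mk (Units.mk0 (-2 : ℚ) (by norm_num)) := by
  rw [QuotientGroup.eq]
  have e : (Units.mk0 (-2048 : ℚ) (by norm_num))⁻¹ * Units.mk0 (-2 : ℚ) (by norm_num) =
      Units.mk0 ((1 : ℚ) / 1024) (by norm_num) := Units.ext (by norm_num)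
  rw [e]
  exact mem_normUnitsSubgroup_of_sq_add_mul_sq _ ((1 : ℚ) / 32) (0 : ℚ) (by norm_num)

/-- … hence NOT the split class (row W6.19.2).
research route conditional on HC_CM; not a corollary; Q11.4-sentence-2 already refuted in dim ≥ 3. [cite: vanGeemen1994HodgeAV, (5.4.1)] -/
theorem sl2_19_rigid_10_5_5_mk_detH_ne_split :
    (QuotientGroup.mk (Units.mk0 (-2048 : ℚ) (by norm_num)) : weilNormResidueGroup 19) ≠
      splitDiscriminantClass 3 19 := by
  rw [sl2_19_rigid_10_5_5_mk_detH_eq_negTwo]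
  exact sixfold_sqrtNeg19_neg2_ne_split

/-! ### `q = 43`: row W6.43.2 = `(3, ℚ(√-43), a ≡ 2)` -/

/-- **the `ξ₂₂`-Prym of the rigid `(14,3,3)`-triangle curve of `SL₂(𝔽₄₃)` (genus 10407; Prym of an 8-point double cover of a genus-3 curve, type `(1³,2³)`; `ℚ(√-43)`-signature `(3,3)`): second-route value `det H = -30208 = -2⁹·59`; `(-30208)⁻¹·(-2) = 1/15104` and `15104 = 64² + 43·16²`, so `1/15104 = (64/15104)² + 43·(16/15104)²` is a norm: class `[-2]` — the NON-split row W6.43.2.**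
research route conditional on HC_CM; not a corollary; Q11.4-sentence-2 already refuted in dim ≥ 3. [cite: vanGeemen1994HodgeAV, (5.4.1)] -/
theorem sl2_43_rigid_14_3_3_mk_detH_eq_negTwo :
    (QuotientGroup.mk (Units.mk0 (-30208 : ℚ) (by norm_num)) : weilNormResidueGroup 43) =
      QuotientGroup.mk (Units.mk0 (-2 : ℚ) (by norm_num)) := by
  rw [QuotientGroup.eq]
  have e : (Units.mk0 (-30208 : ℚ) (by norm_num))⁻¹ * Units.mk0 (-2 : ℚ) (by norm_num) =
      Units.mk0 ((1 : ℚ) / 15104) (by norm_num) := Units.ext (by norm_num)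
  rw [e]
  exact mem_normUnitsSubgroup_of_sq_add_mul_sq _ ((64 : ℚ) / 15104) ((16 : ℚ) / 15104) (by norm_num)

/-- … hence NOT the split class (row W6.43.2).
research route conditional on HC_CM; not a corollary; Q11.4-sentence-2 already refuted in dim ≥ 3. [cite: vanGeemen1994HodgeAV, (5.4.1)] -/
theorem sl2_43_rigid_14_3_3_mk_detH_ne_split :
    (QuotientGroup.mk (Units.mk0 (-30208 : ℚ) (by norm_num)) : weilNormResidueGroup 43) ≠
      splitDiscriminantClass 3 43 := by
  rw [sl2_43_rigid_14_3_3_mk_detH_eq_negTwo]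
  exact sixfold_sqrtNeg43_neg2_ne_split

end Summit.HodgeConjecture.HodgeConjecture.Ring2.WeilCoverage

end
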